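import Literature.Computability.Complexity.UniformDerandomizationSelectReduction
import Literature.Computability.Complexity.TruthTableFunctions
import Literature.Computability.Complexity.OracleCompositionUniform
import Literature.Computability.Complexity.FoldBricks
import Literature.Computability.Complexity.StackBricks
import HarnessLib

/-!
# Weak-to-strong constructions of circuits by testing, III: the truth-table transducer

Literature / complexity — derandomization under a uniform assumption; sequel of
`UniformDerandomizationSelectByTesting.lean` (counting) and `UniformDerandomizationSelectReduction.lean`
(`IWUniform.reducibleUsing_of_selOut`: `A →^{fₙ} C^{f,1−2/D}` for any polynomial-time oracle
algorithm whose run outputs `IWUniform.Select.selOut`). Here that algorithm is BUILT, once and for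
all, from an arbitrary WEAK one-run stage given by two `FP` maps — a query generator `Q₁` (run
query `u` on `⟨⟨1ⁿ, run block⟩, 1ᵘ⟩`, oblivious of the instance) and a candidate map `G₁`
(`⟨⟨1ⁿ, ⟨z, run block⟩⟩, answer bits⟩ ↦` description) — as the non-adaptive transducer
`ttFnAlg Q q G` of `TruthTableFunctions.lean` (semantics against arbitrary oracles:
`run_ttFnAlg_oracle`, `OracleCompositionUniform.lean`): on `x = ⟨z, ⟨1ⁿ, ⟨1ᵃ, r⟩⟩⟩` it asks, for
each of `T = 4aP` trials, the `nQ` run queries of the weak stage on the trial's run block and `m`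
test points cut out of the trial's coin block, and outputs the candidate of the first trial whose
candidate disagrees with the oracle's labels on at most `3m/(2D)` test points
(IW98 Lemma 18, end of proof; Lemma 14).

* accessors and unary parameters read off `x` (`SelectT.nF`, `aF`, `rF`, `PuF`, …, `TF`, `mF`,
  `cF`, `KF`), trial blocks `blockF`, run blocks `rbF`, test points `testPtF`;
* **`SelectT.qryF`** — the query function `Q` (`qryF_mem_FP`, value `qryF_apply`);
* **`SelectT.outF`** — the output function `G`: per trial the candidate `candTF`, its empirical
  error `errsF` (a fold of one-bit error pieces over the test points), the acceptance test `accF`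
  (`2·errs·D ≤ 3m`), and the fold `firstOpF` keeping the first accepted candidate
  (`outF_mem_FP`, value **`outF_apply`** `= Select.selOut …`);
* `SelectT.candOf` — the candidate of a run block as a function of `f` (the weak stage's output
  when the oracle answers `f`), in terms of which the weak hypothesis is stated;
* **`IWUniform.reducibleUsing_of_weakStage`** — the packaged reduction: if for every `z ∈ Aₙ` the
  weak stage's candidate has error `≤ 1/D(n)` with probability `≥ 1/P(n)` over the run block, then
  `ReducibleUsing A (approxCircuits Ev f (2/D)) f id`.

Everything is proved; the definitions are explicit string functions (no named facts).

## References

* [ImpagliazzoWigderson2001] R. Impagliazzo, A. Wigderson, JCSS 63 (2001) 672–688, §2.2, Def. 4,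
  Lemma 14, Lemma 18 (proof, last paragraph; held text pp. 6–8).
* [LadnerLynchSelman1975] R. Ladner, N. Lynch, A. Selman, TCS 1 (1975), §3.
* [AroraBarakCC2009] S. Arora, B. Barak, CUP 2009, §3.4, §1.3, §7.4.1.
-/

noncomputable section

namespace Literature.Computability.Complexity

namespace IWUniform

namespace SelectT

open _root_.Computability Polynomial Brick Plumb HashBricks

variable (Ev Q₁ G₁ : List Bool → List Bool) (pP pD pB pNQ padP : Polynomial ℕ)

/-! ### Accessors and unary parameters on the transducer input `x = ⟨z, ⟨1ⁿ, ⟨1ᵃ, r⟩⟩⟩` -/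

/-- `z`. [folklore] -/
def zF : List Bool → List Bool := fstF
/-- `1ⁿ`. [folklore] -/
def nF : List Bool → List Bool := fstF ∘ sndF
/-- `1ᵃ`. [folklore] -/
def aF : List Bool → List Bool := fstF ∘ sndF ∘ sndF
/-- the coins `r`. [folklore] -/
def rF : List Bool → List Bool := sndF ∘ sndF ∘ sndF
/-- `1^{P(n)}` (inverse success of the weak stage). [folklore] -/
def PuF : List Bool → List Bool := polyFn pP ∘ nF
/-- `1^{D(n)}` (inverse error of the weak stage). [folklore] -/
def DuF : List Bool → List Bool := polyFn pD ∘ nF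
/-- `1^{P₁(n)}` (run-block length). [folklore] -/
def P1F : List Bool → List Bool := polyFn pB ∘ nF
/-- `1^{nQ(n)}` (run queries). [folklore] -/
def nQF : List Bool → List Bool := polyFn pNQ ∘ nF
/-- `1^{T}`, `T = 4aP`. [cite: ImpagliazzoWigderson2001, §2.2] -/
def TF : List Bool → List Bool := umulFn ∘ fanoutFn (umulFn ∘ fanoutFn (fun _ => ones 4) aF) (PuF pP)
/-- `1^{m}`, `m = 64D²a²P`. [cite: ImpagliazzoWigderson2001, §2.2] -/
def mF : List Bool → List Bool :=
  umulFn ∘ fanoutFn (umulFn ∘ fanoutFn (umulFn ∘ fanoutFn (umulFn ∘ fanoutFn (fun _ => ones 64) (DuF pD)) (DuF pD))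
    (umulFn ∘ fanoutFn aF aF)) (PuF pP)
/-- `1^{c}`, `c = P₁ + m n` (trial block). [folklore] -/
def cF : List Bool → List Bool := appF ∘ fanoutFn (P1F pB) (umulFn ∘ fanoutFn (mF pP pD) nF)
/-- `1^{K}`, `K = nQ + m` (queries per trial). [folklore] -/
def KF : List Bool → List Bool := appF ∘ fanoutFn (nQF pNQ) (mF pP pD)

/-- **Trial block `τ`** on `⟨x, 1^τ⟩`: `(r ⇂ τc) ↾ c`. [folklore] -/
def blockF : List Bool → List Bool :=
  takeFn ∘ fanoutFn (cF pP pD pB ∘ fstF) (dropFn ∘ fanoutFn (umulFn ∘ fanoutFn sndF (cF pP pD pB ∘ fstF)) (rF ∘ fstF))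
/-- **Run block of trial `τ`** on `⟨x, 1^τ⟩`: the first `P₁` bits of the trial block. [folklore] -/
def rbF : List Bool → List Bool := takeFn ∘ fanoutFn (P1F pB ∘ fstF) (blockF pP pD pB)
/-- **Test point `s` of trial `τ`** on `⟨⟨x, 1^τ⟩, 1ˢ⟩`: `((block ⇂ (P₁ + s n)) ↾ n`. [folklore] -/
def testPtF : List Bool → List Bool :=
  takeFn ∘ fanoutFn (nF ∘ fstF ∘ fstF)
    (dropFn ∘ fanoutFn (appF ∘ fanoutFn (P1F pB ∘ fstF ∘ fstF) (umulFn ∘ fanoutFn sndF (nF ∘ fstF ∘ fstF)))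
      (blockF pP pD pB ∘ fstF))

/-! ### The query function -/

/-- **The query of global index `U`** on `⟨x, 1^U⟩`, `U = τK + v`: run query `v` of the weak stage
on the run block of trial `τ` if `v < nQ`, else test point `v − nQ` of trial `τ`.
[cite: ImpagliazzoWigderson2001, Lemma 18 (proof: queries of the construction, then random samples)] -/
def qryF : List Bool → List Bool :=
  iteFn (ltLenF ∘ fanoutFn (sndF ∘ divModFn ∘ fanoutFn (KF pP pD pNQ ∘ fstF) sndF) (nQF pNQ ∘ fstF))
    (Q₁ ∘ fanoutFn (fanoutFn (nF ∘ fstF) (rbF pP pD pB ∘ fanoutFn fstF (fstF ∘ divModFn ∘ fanoutFn (KF pP pD pNQ ∘ fstF) sndF)))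
      (sndF ∘ divModFn ∘ fanoutFn (KF pP pD pNQ ∘ fstF) sndF))
    (testPtF pP pD pB ∘ fanoutFn (fanoutFn fstF (fstF ∘ divModFn ∘ fanoutFn (KF pP pD pNQ ∘ fstF) sndF))
      (dropFn ∘ fanoutFn (nQF pNQ ∘ fstF) (sndF ∘ divModFn ∘ fanoutFn (KF pP pD pNQ ∘ fstF) sndF)))

/-! ### The output function -/

/-- Context of the trial fold: `X' = ⟨X, pad⟩`, `X = ⟨x, A⟩` (input and all answer bits); on
`Y = ⟨X', 1^τ⟩` the accessors of `x`, `A`, `τ`. [folklore] -/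
def xY : List Bool → List Bool := fstF ∘ fstF ∘ fstF
/-- the answer bits `A` on `Y`. [folklore] -/
def aY : List Bool → List Bool := sndF ∘ fstF ∘ fstF
/-- `1^τ` on `Y`. [folklore] -/
def tY : List Bool → List Bool := sndF

/-- **The answers of trial `τ`** on `Y`: `(A ⇂ τK) ↾ K`. [folklore] -/
def ansF : List Bool → List Bool :=
  takeFn ∘ fanoutFn (KF pP pD pNQ ∘ xY) (dropFn ∘ fanoutFn (umulFn ∘ fanoutFn tY (KF pP pD pNQ ∘ xY)) aY)
/-- **The candidate of trial `τ`** on `Y`: `G₁ ⟨⟨1ⁿ, ⟨z, run block⟩⟩, run answers⟩`.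
[cite: ImpagliazzoWigderson2001, Lemma 18 (proof: the construction)] -/
def candTF : List Bool → List Bool :=
  G₁ ∘ fanoutFn (fanoutFn (nF ∘ xY) (fanoutFn (zF ∘ xY) (rbF pP pD pB ∘ fanoutFn xY tY)))
    (takeFn ∘ fanoutFn (nQF pNQ ∘ xY) (ansF pP pD pNQ))
/-- The labels of the test points of trial `τ` on `Y`: the last `m` answer bits of the trial. [folklore] -/
def testAnsF : List Bool → List Bool := dropFn ∘ fanoutFn (nQF pNQ ∘ xY) (ansF pP pD pNQ)

/-- **One error piece** on `⟨Y, 1ˢ⟩`: `ε` if `Ev ⟨candidate, test point s⟩` equals the label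
`[aₛ]`, `1` otherwise. [cite: ImpagliazzoWigderson2001, Lemma 18 (proof: "estimate the probability that C(x) = h(x)")] -/
def errPieceF : List Bool → List Bool :=
  iteFn (eqPairFn ∘ fanoutFn (Ev ∘ fanoutFn (candTF G₁ pP pD pB pNQ ∘ fstF) (testPtF pP pD pB ∘ fanoutFn (fanoutFn (xY ∘ fstF) (tY ∘ fstF)) sndF))
      (takeFn ∘ fanoutFn (fun _ => ones 1) (dropFn ∘ fanoutFn sndF (testAnsF pP pD pNQ ∘ fstF))))
    (fun _ => []) (fun _ => [true])

/-- **The empirical error** `1^{errs}` of trial `τ` on `Y`: the concatenation of the error pieces over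
`s < m`. [folklore] -/
def errsF : List Bool → List Bool :=
  sndPow 2 ∘ foldLoop appF (clipF 1 (errPieceF Ev G₁ pP pD pB pNQ)) (64 * pD ^ 2 * X ^ 2 * pP) ∘
    fanoutFn (fun w => w) (fanoutFn (lenBinF ∘ mF pP pD ∘ xY) (fun _ => boolPair [] []))

/-- **Acceptance of trial `τ`** on `Y`: `[2 · errs · D ≤ 3m]`. [cite: ImpagliazzoWigderson2001, Lemma 18 (proof: "if greater than …, output C")] -/
def accF : List Bool → List Bool :=
  notFn (ltLenF ∘ fanoutFn (appF ∘ fanoutFn (mF pP pD ∘ xY) (appF ∘ fanoutFn (mF pP pD ∘ xY) (mF pP pD ∘ xY)))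
    (umulFn ∘ fanoutFn (appF ∘ fanoutFn (errsF Ev G₁ pP pD pB pNQ) (errsF Ev G₁ pP pD pB pNQ)) (DuF pD ∘ xY)))

/-- **The piece of trial `τ`** on `Y`: `⟨1, candidate⟩` if accepted, `ε` otherwise. [folklore] -/
def pieceTF : List Bool → List Bool :=
  iteFn (accF Ev G₁ pP pD pB pNQ) (fanoutFn (fun _ => [true]) (candTF G₁ pP pD pB pNQ)) (fun _ => [])

/-- **Keep the first non-empty piece**: `⟨acc, piece⟩ ↦ piece` if `acc = ε`, else `acc`.
[cite: ImpagliazzoWigderson2001, Lemma 18 (proof: "output C, else repeat")] -/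
def firstOpF : List Bool → List Bool := iteFn (isNilFn ∘ fstF) sndF fstF

/-- The initial record of the trial fold on `X = ⟨x, A⟩`: `⟨⟨X, pad⟩, ⟨bin T, ⟨ε, ε⟩⟩⟩`. [folklore] -/
def initTF : List Bool → List Bool :=
  fanoutFn (fanoutFn (fun w => w) (polyFn padP)) (fanoutFn (lenBinF ∘ TF pP ∘ fstF) (fun _ => boolPair [] []))

/-- **The output function `G`** on `X = ⟨x, A⟩`: the candidate of the first accepted trial (`ε` if
none). [cite: ImpagliazzoWigderson2001, Lemma 18 (proof)] -/
def outF : List Bool → List Bool :=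
  sndF ∘ sndPow 2 ∘ foldLoop firstOpF (clipF 5 (pieceTF Ev G₁ pP pD pB pNQ)) (4 * X * pP) ∘ initTF pP padP

/-! ### Membership in `FP` -/

section FP

variable {Ev Q₁ G₁}

/-- `nF` is in `FP`. [folklore] -/
theorem nF_mem_FP : nF ∈ FP := comp_mem_FP fstF_mem_FP sndF_mem_FP
/-- `aF` is in `FP`. [folklore] -/
theorem aF_mem_FP : aF ∈ FP := comp_mem_FP fstF_mem_FP (comp_mem_FP sndF_mem_FP sndF_mem_FP)
/-- `rF` is in `FP`. [folklore] -/
theorem rF_mem_FP : rF ∈ FP := comp_mem_FP sndF_mem_FP (comp_mem_FP sndF_mem_FP sndF_mem_FP)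
/-- `PuF` is in `FP`. [folklore] -/
theorem PuF_mem_FP : PuF pP ∈ FP := comp_mem_FP (polyFn_mem_FP _) nF_mem_FP
/-- `DuF` is in `FP`. [folklore] -/
theorem DuF_mem_FP : DuF pD ∈ FP := comp_mem_FP (polyFn_mem_FP _) nF_mem_FP
/-- `P1F` is in `FP`. [folklore] -/
theorem P1F_mem_FP : P1F pB ∈ FP := comp_mem_FP (polyFn_mem_FP _) nF_mem_FP
/-- `nQF` is in `FP`. [folklore] -/
theorem nQF_mem_FP : nQF pNQ ∈ FP := comp_mem_FP (polyFn_mem_FP _) nF_mem_FP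
/-- `TF` is in `FP`. [folklore] -/
theorem TF_mem_FP : TF pP ∈ FP :=
  comp_mem_FP umulFn_mem_FP (fanoutFn_mem_FP (comp_mem_FP umulFn_mem_FP (fanoutFn_mem_FP (const_mem_FP _) aF_mem_FP)) (PuF_mem_FP pP))
/-- `mF` is in `FP`. [folklore] -/
theorem mF_mem_FP : mF pP pD ∈ FP :=
  comp_mem_FP umulFn_mem_FP (fanoutFn_mem_FP (comp_mem_FP umulFn_mem_FP (fanoutFn_mem_FP
    (comp_mem_FP umulFn_mem_FP (fanoutFn_mem_FP (comp_mem_FP umulFn_mem_FP (fanoutFn_mem_FP (const_mem_FP _) (DuF_mem_FP pD))) (DuF_mem_FP pD)))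
    (comp_mem_FP umulFn_mem_FP (fanoutFn_mem_FP aF_mem_FP aF_mem_FP)))) (PuF_mem_FP pP))
/-- `cF` is in `FP`. [folklore] -/
theorem cF_mem_FP : cF pP pD pB ∈ FP :=
  comp_mem_FP appF_mem_FP (fanoutFn_mem_FP (P1F_mem_FP pB) (comp_mem_FP umulFn_mem_FP (fanoutFn_mem_FP (mF_mem_FP pP pD) nF_mem_FP)))
/-- `KF` is in `FP`. [folklore] -/
theorem KF_mem_FP : KF pP pD pNQ ∈ FP := comp_mem_FP appF_mem_FP (fanoutFn_mem_FP (nQF_mem_FP pNQ) (mF_mem_FP pP pD))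
/-- `blockF` is in `FP`. [folklore] -/
theorem blockF_mem_FP : blockF pP pD pB ∈ FP :=
  comp_mem_FP takeFn_mem_FP (fanoutFn_mem_FP (comp_mem_FP (cF_mem_FP pP pD pB) fstF_mem_FP)
    (comp_mem_FP dropFn_mem_FP (fanoutFn_mem_FP (comp_mem_FP umulFn_mem_FP (fanoutFn_mem_FP sndF_mem_FP (comp_mem_FP (cF_mem_FP pP pD pB) fstF_mem_FP)))
      (comp_mem_FP rF_mem_FP fstF_mem_FP))))
/-- `rbF` is in `FP`. [folklore] -/
theorem rbF_mem_FP : rbF pP pD pB ∈ FP :=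
  comp_mem_FP takeFn_mem_FP (fanoutFn_mem_FP (comp_mem_FP (P1F_mem_FP pB) fstF_mem_FP) (blockF_mem_FP pP pD pB))
/-- `testPtF` is in `FP`. [folklore] -/
theorem testPtF_mem_FP : testPtF pP pD pB ∈ FP :=
  comp_mem_FP takeFn_mem_FP (fanoutFn_mem_FP (comp_mem_FP nF_mem_FP (comp_mem_FP fstF_mem_FP fstF_mem_FP))
    (comp_mem_FP dropFn_mem_FP (fanoutFn_mem_FP
      (comp_mem_FP appF_mem_FP (fanoutFn_mem_FP (comp_mem_FP (P1F_mem_FP pB) (comp_mem_FP fstF_mem_FP fstF_mem_FP))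
        (comp_mem_FP umulFn_mem_FP (fanoutFn_mem_FP sndF_mem_FP (comp_mem_FP nF_mem_FP (comp_mem_FP fstF_mem_FP fstF_mem_FP))))))
      (comp_mem_FP (blockF_mem_FP pP pD pB) fstF_mem_FP))))

/-- `dm` is in `FP`. [folklore] -/
private theorem dm_mem_FP : (sndF ∘ divModFn ∘ fanoutFn (KF pP pD pNQ ∘ fstF) sndF) ∈ FP :=
  comp_mem_FP sndF_mem_FP (comp_mem_FP divModFn_mem_FP (fanoutFn_mem_FP (comp_mem_FP (KF_mem_FP pP pD pNQ) fstF_mem_FP) sndF_mem_FP))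
/-- `dd` is in `FP`. [folklore] -/
private theorem dd_mem_FP : (fstF ∘ divModFn ∘ fanoutFn (KF pP pD pNQ ∘ fstF) sndF) ∈ FP :=
  comp_mem_FP fstF_mem_FP (comp_mem_FP divModFn_mem_FP (fanoutFn_mem_FP (comp_mem_FP (KF_mem_FP pP pD pNQ) fstF_mem_FP) sndF_mem_FP))

/-- `qryF ∈ FP` for `Q₁ ∈ FP`. [cite: AroraBarakCC2009, §1.3] -/
theorem qryF_mem_FP (hQ : Q₁ ∈ FP) : qryF Q₁ pP pD pB pNQ ∈ FP :=
  iteFn_mem_FP (comp_mem_FP ltLenF_mem_FP (fanoutFn_mem_FP (dm_mem_FP pP pD pNQ) (comp_mem_FP (nQF_mem_FP pNQ) fstF_mem_FP)))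
    (comp_mem_FP hQ (fanoutFn_mem_FP (fanoutFn_mem_FP (comp_mem_FP nF_mem_FP fstF_mem_FP)
      (comp_mem_FP (rbF_mem_FP pP pD pB) (fanoutFn_mem_FP fstF_mem_FP (dd_mem_FP pP pD pNQ)))) (dm_mem_FP pP pD pNQ)))
    (comp_mem_FP (testPtF_mem_FP pP pD pB) (fanoutFn_mem_FP (fanoutFn_mem_FP fstF_mem_FP (dd_mem_FP pP pD pNQ))
      (comp_mem_FP dropFn_mem_FP (fanoutFn_mem_FP (comp_mem_FP (nQF_mem_FP pNQ) fstF_mem_FP) (dm_mem_FP pP pD pNQ)))))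

/-- `xY` is in `FP`. [folklore] -/
theorem xY_mem_FP : xY ∈ FP := comp_mem_FP fstF_mem_FP (comp_mem_FP fstF_mem_FP fstF_mem_FP)
/-- `aY` is in `FP`. [folklore] -/
theorem aY_mem_FP : aY ∈ FP := comp_mem_FP sndF_mem_FP (comp_mem_FP fstF_mem_FP fstF_mem_FP)
/-- `tY` is in `FP`. [folklore] -/
theorem tY_mem_FP : tY ∈ FP := sndF_mem_FP
/-- `ansF` is in `FP`. [folklore] -/
theorem ansF_mem_FP : ansF pP pD pNQ ∈ FP :=
  comp_mem_FP takeFn_mem_FP (fanoutFn_mem_FP (comp_mem_FP (KF_mem_FP pP pD pNQ) xY_mem_FP)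
    (comp_mem_FP dropFn_mem_FP (fanoutFn_mem_FP (comp_mem_FP umulFn_mem_FP (fanoutFn_mem_FP tY_mem_FP (comp_mem_FP (KF_mem_FP pP pD pNQ) xY_mem_FP))) aY_mem_FP)))
/-- `candTF` is in `FP`. [folklore] -/
theorem candTF_mem_FP (hG : G₁ ∈ FP) : candTF G₁ pP pD pB pNQ ∈ FP :=
  comp_mem_FP hG (fanoutFn_mem_FP (fanoutFn_mem_FP (comp_mem_FP nF_mem_FP xY_mem_FP)
    (fanoutFn_mem_FP (comp_mem_FP fstF_mem_FP xY_mem_FP) (comp_mem_FP (rbF_mem_FP pP pD pB) (fanoutFn_mem_FP xY_mem_FP tY_mem_FP))))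
    (comp_mem_FP takeFn_mem_FP (fanoutFn_mem_FP (comp_mem_FP (nQF_mem_FP pNQ) xY_mem_FP) (ansF_mem_FP pP pD pNQ))))
/-- `testAnsF` is in `FP`. [folklore] -/
theorem testAnsF_mem_FP : testAnsF pP pD pNQ ∈ FP :=
  comp_mem_FP dropFn_mem_FP (fanoutFn_mem_FP (comp_mem_FP (nQF_mem_FP pNQ) xY_mem_FP) (ansF_mem_FP pP pD pNQ))
/-- `errPieceF` is in `FP`. [folklore] -/
theorem errPieceF_mem_FP (hEv : Ev ∈ FP) (hG : G₁ ∈ FP) : errPieceF Ev G₁ pP pD pB pNQ ∈ FP :=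
  iteFn_mem_FP (comp_mem_FP eqPairFn_mem_FP (fanoutFn_mem_FP
      (comp_mem_FP hEv (fanoutFn_mem_FP (comp_mem_FP (candTF_mem_FP pP pD pB pNQ hG) fstF_mem_FP)
        (comp_mem_FP (testPtF_mem_FP pP pD pB) (fanoutFn_mem_FP (fanoutFn_mem_FP (comp_mem_FP xY_mem_FP fstF_mem_FP) (comp_mem_FP tY_mem_FP fstF_mem_FP)) sndF_mem_FP))))
      (comp_mem_FP takeFn_mem_FP (fanoutFn_mem_FP (const_mem_FP _) (comp_mem_FP dropFn_mem_FP (fanoutFn_mem_FP sndF_mem_FP (comp_mem_FP (testAnsF_mem_FP pP pD pNQ) fstF_mem_FP)))))))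
    (const_mem_FP _) (const_mem_FP _)
/-- `errsF` is in `FP`. [folklore] -/
theorem errsF_mem_FP (hEv : Ev ∈ FP) (hG : G₁ ∈ FP) : errsF Ev G₁ pP pD pB pNQ ∈ FP :=
  comp_mem_FP (sndPow_mem_FP 2) (comp_mem_FP
    (foldLoop_clipF_mem_FP 1 appF_mem_FP length_appF_le (errPieceF_mem_FP pP pD pB pNQ hEv hG) _)
    (fanoutFn_mem_FP OracleCompose.id_mem_FP (fanoutFn_mem_FP (comp_mem_FP lenBinF_mem_FP (comp_mem_FP (mF_mem_FP pP pD) xY_mem_FP)) (const_mem_FP _))))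
/-- `accF` is in `FP`. [folklore] -/
theorem accF_mem_FP (hEv : Ev ∈ FP) (hG : G₁ ∈ FP) : accF Ev G₁ pP pD pB pNQ ∈ FP :=
  notFn_mem_FP (comp_mem_FP ltLenF_mem_FP (fanoutFn_mem_FP
    (comp_mem_FP appF_mem_FP (fanoutFn_mem_FP (comp_mem_FP (mF_mem_FP pP pD) xY_mem_FP)
      (comp_mem_FP appF_mem_FP (fanoutFn_mem_FP (comp_mem_FP (mF_mem_FP pP pD) xY_mem_FP) (comp_mem_FP (mF_mem_FP pP pD) xY_mem_FP)))))
    (comp_mem_FP umulFn_mem_FP (fanoutFn_mem_FP (comp_mem_FP appF_mem_FP (fanoutFn_mem_FP (errsF_mem_FP pP pD pB pNQ hEv hG) (errsF_mem_FP pP pD pB pNQ hEv hG)))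
      (comp_mem_FP (DuF_mem_FP pD) xY_mem_FP)))))
/-- `pieceTF` is in `FP`. [folklore] -/
theorem pieceTF_mem_FP (hEv : Ev ∈ FP) (hG : G₁ ∈ FP) : pieceTF Ev G₁ pP pD pB pNQ ∈ FP :=
  iteFn_mem_FP (accF_mem_FP pP pD pB pNQ hEv hG) (fanoutFn_mem_FP (const_mem_FP _) (candTF_mem_FP pP pD pB pNQ hG)) (const_mem_FP _)
/-- `firstOpF` is in `FP`. [folklore] -/
theorem firstOpF_mem_FP : firstOpF ∈ FP := iteFn_mem_FP (comp_mem_FP isNilFn_mem_FP fstF_mem_FP) sndF_mem_FP fstF_mem_FP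

/-- `firstOpF` has additive growth. [folklore] -/
theorem length_firstOpF_le (w : List Bool) : (firstOpF w).length ≤ (fstF w).length + (sndF w).length + 0 := by
  unfold firstOpF
  have hc : (isNilFn ∘ fstF) w = [decide (fstF w = [])] := rfl
  rw [iteFn_apply hc]
  split_ifs <;> omega

/-- `initTF` is in `FP`. [folklore] -/
theorem initTF_mem_FP : initTF pP padP ∈ FP :=
  fanoutFn_mem_FP (fanoutFn_mem_FP OracleCompose.id_mem_FP (polyFn_mem_FP _))
    (fanoutFn_mem_FP (comp_mem_FP lenBinF_mem_FP (comp_mem_FP (TF_mem_FP pP) fstF_mem_FP)) (const_mem_FP _))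

/-- **`outF ∈ FP`** for `Ev, G₁ ∈ FP`. [cite: AroraBarakCC2009, §1.3] -/
theorem outF_mem_FP (hEv : Ev ∈ FP) (hG : G₁ ∈ FP) : outF Ev G₁ pP pD pB pNQ padP ∈ FP :=
  comp_mem_FP sndF_mem_FP (comp_mem_FP (sndPow_mem_FP 2) (comp_mem_FP
    (foldLoop_clipF_mem_FP 5 firstOpF_mem_FP length_firstOpF_le (pieceTF_mem_FP pP pD pB pNQ hEv hG) _) (initTF_mem_FP pP padP)))

end FP

/-! ### Values on a genuine input -/

section Values

variable {Ev Q₁ G₁}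

/-- The transducer input `⟨z, ⟨1ⁿ, ⟨1ᵃ, r⟩⟩⟩` (`= reduceInput z n a r`, `reduceInput_eq_xIn`). [folklore] -/
def xIn (z : List Bool) (n a : ℕ) (r : List Bool) : List Bool :=
  boolPair z (boolPair (ones n) (boolPair (ones a) r))

/-- `unaryEncodeNat k = 1ᵏ`. [folklore] -/
private theorem unaryEncodeNat_eq_ones (k : ℕ) : unaryEncodeNat k = ones k := by
  induction k with
  | zero => rfl
  | succ k ih => simp [unaryEncodeNat, ih, ones, List.replicate_succ]

/-- `reduceInput` is `xIn`. [folklore] -/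
theorem reduceInput_eq_xIn (z : List Bool) (n a : ℕ) (r : List Bool) : reduceInput z n a r = xIn z n a r := by
  simp [reduceInput, strongInput, xIn, unaryEncodeNat_eq_ones]

/-- `1ᵃ ++ 1ᵇ = 1ᵃ⁺ᵇ`. [folklore] -/
private theorem ones_append (a b : ℕ) : ones a ++ ones b = ones (a + b) := List.replicate_append_replicate ..

variable (z : List Bool) (n a : ℕ) (r : List Bool)

/-- Value of `zF` on a genuine input. [folklore] -/
@[simp] theorem zF_xIn : zF (xIn z n a r) = z := by simp [zF, xIn]
/-- Value of `nF` on a genuine input. [folklore] -/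
@[simp] theorem nF_xIn : nF (xIn z n a r) = ones n := by simp [nF, xIn]
/-- Value of `aF` on a genuine input. [folklore] -/
@[simp] theorem aF_xIn : aF (xIn z n a r) = ones a := by simp [aF, xIn]
/-- Value of `rF` on a genuine input. [folklore] -/
@[simp] theorem rF_xIn : rF (xIn z n a r) = r := by simp [rF, xIn]
/-- Value of `PuF` on a genuine input. [folklore] -/
@[simp] theorem PuF_xIn : PuF pP (xIn z n a r) = ones (pP.eval n) := by simp [PuF, ones]
/-- Value of `DuF` on a genuine input. [folklore] -/
@[simp] theorem DuF_xIn : DuF pD (xIn z n a r) = ones (pD.eval n) := by simp [DuF, ones]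
/-- Value of `P1F` on a genuine input. [folklore] -/
@[simp] theorem P1F_xIn : P1F pB (xIn z n a r) = ones (pB.eval n) := by simp [P1F, ones]
/-- Value of `nQF` on a genuine input. [folklore] -/
@[simp] theorem nQF_xIn : nQF pNQ (xIn z n a r) = ones (pNQ.eval n) := by simp [nQF, ones]
/-- Value of `TF` on a genuine input. [folklore] -/
@[simp] theorem TF_xIn : TF pP (xIn z n a r) = ones (4 * a * pP.eval n) := by
  simp [TF, umulFn_boolPair]

/-- The number of test points `m = 64D²a²P`, in the product shape the machine computes. [folklore] -/
def mOf (P D a : ℕ) : ℕ := 64 * D * D * (a * a) * P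

/-- `mOf` is `64 D² a² P`. [folklore] -/
theorem mOf_eq (P D a : ℕ) : mOf P D a = 64 * D ^ 2 * a ^ 2 * P := by rw [mOf]; ring

/-- Value of `mF` on a genuine input. [folklore] -/
@[simp] theorem mF_xIn : mF pP pD (xIn z n a r) = ones (mOf (pP.eval n) (pD.eval n) a) := by
  simp [mF, umulFn_boolPair, mOf]
/-- Value of `cF` on a genuine input. [folklore] -/
@[simp] theorem cF_xIn : cF pP pD pB (xIn z n a r) = ones (pB.eval n + mOf (pP.eval n) (pD.eval n) a * n) := by
  simp [cF, umulFn_boolPair, ones]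
/-- Value of `KF` on a genuine input. [folklore] -/
@[simp] theorem KF_xIn : KF pP pD pNQ (xIn z n a r) = ones (pNQ.eval n + mOf (pP.eval n) (pD.eval n) a) := by
  simp [KF, ones]

/-- **Value of `blockF`**: trial block `τ` is `BPPAmp.block c τ r`. [folklore] -/
theorem blockF_apply (τ : ℕ) :
    blockF pP pD pB (boolPair (xIn z n a r) (ones τ)) =
      BPPAmp.block (pB.eval n + mOf (pP.eval n) (pD.eval n) a * n) τ r := by
  simp [blockF, umulFn_boolPair, BPPAmp.block, ones]

/-- **Value of `rbF`**: the run block of trial `τ`. [folklore] -/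
theorem rbF_apply (τ : ℕ) :
    rbF pP pD pB (boolPair (xIn z n a r) (ones τ)) =
      (BPPAmp.block (pB.eval n + mOf (pP.eval n) (pD.eval n) a * n) τ r).take (pB.eval n) := by
  rw [rbF, Function.comp_apply, fanoutFn_apply, blockF_apply, Function.comp_apply, fstF_boolPair, P1F_xIn, takeFn_boolPair]
  simp [ones]

/-- **Value of `testPtF`**: test point `s` of trial `τ` is block `s` (of `n` bits) of the trial block
past its run block. [folklore] -/
theorem testPtF_apply (τ s : ℕ) :
    testPtF pP pD pB (boolPair (boolPair (xIn z n a r) (ones τ)) (ones s)) =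
      BPPAmp.block n s ((BPPAmp.block (pB.eval n + mOf (pP.eval n) (pD.eval n) a * n) τ r).drop (pB.eval n)) := by
  simp only [testPtF, Function.comp_apply, fanoutFn_apply, fstF_boolPair, sndF_boolPair, nF_xIn, P1F_xIn,
    umulFn_boolPair, appF_boolPair, ones_append, blockF_apply, dropFn_boolPair, takeFn_boolPair]
  simp [BPPAmp.block, ones, List.drop_drop]

/-- **Value of the query function.** [cite: ImpagliazzoWigderson2001, Lemma 18 (proof)] -/
theorem qryF_apply (U : ℕ) :
    qryF Q₁ pP pD pB pNQ (boolPair (xIn z n a r) (ones U)) =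
      if U % (pNQ.eval n + mOf (pP.eval n) (pD.eval n) a) < pNQ.eval n then
        Q₁ (boolPair (boolPair (ones n)
            ((BPPAmp.block (pB.eval n + mOf (pP.eval n) (pD.eval n) a * n) (U / (pNQ.eval n + mOf (pP.eval n) (pD.eval n) a)) r).take
              (pB.eval n)))
          (ones (U % (pNQ.eval n + mOf (pP.eval n) (pD.eval n) a))))
      else BPPAmp.block n (U % (pNQ.eval n + mOf (pP.eval n) (pD.eval n) a) - pNQ.eval n)
        ((BPPAmp.block (pB.eval n + mOf (pP.eval n) (pD.eval n) a * n) (U / (pNQ.eval n + mOf (pP.eval n) (pD.eval n) a)) r).drop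
          (pB.eval n)) := by
  have hc : (ltLenF ∘ fanoutFn (sndF ∘ divModFn ∘ fanoutFn (KF pP pD pNQ ∘ fstF) sndF) (nQF pNQ ∘ fstF))
      (boolPair (xIn z n a r) (ones U)) = [decide (U % (pNQ.eval n + mOf (pP.eval n) (pD.eval n) a) < pNQ.eval n)] := by
    simp only [Function.comp_apply, fanoutFn_apply, fstF_boolPair, sndF_boolPair, KF_xIn, divModFn_boolPair, nQF_xIn,
      ltLenF_boolPair, List.length_replicate]
  rw [qryF, iteFn_apply hc]
  by_cases h : U % (pNQ.eval n + mOf (pP.eval n) (pD.eval n) a) < pNQ.eval n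
  · rw [decide_eq_true h, if_pos rfl, if_pos h]
    simp only [Function.comp_apply, fanoutFn_apply, fstF_boolPair, sndF_boolPair, KF_xIn, divModFn_boolPair, nF_xIn, rbF_apply]
  · rw [decide_eq_false h, if_neg Bool.false_ne_true, if_neg h]
    simp only [Function.comp_apply, fanoutFn_apply, fstF_boolPair, sndF_boolPair, KF_xIn, divModFn_boolPair, nQF_xIn,
      dropFn_boolPair, List.length_replicate, ones, List.drop_replicate]
    exact testPtF_apply pP pD pB z n a r _ _

/-! #### The trial fold context -/

variable (A pad : List Bool)

/-- The context `Y = ⟨⟨⟨x, A⟩, pad⟩, 1^τ⟩` of the trial fold. [folklore] -/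
def yIn (τ : ℕ) : List Bool := boolPair (boolPair (boolPair (xIn z n a r) A) pad) (ones τ)

/-- Value of `xY` on a genuine input. [folklore] -/
@[simp] theorem xY_yIn (τ : ℕ) : xY (yIn z n a r A pad τ) = xIn z n a r := by simp [xY, yIn]
/-- Value of `aY` on a genuine input. [folklore] -/
@[simp] theorem aY_yIn (τ : ℕ) : aY (yIn z n a r A pad τ) = A := by simp [aY, yIn]
/-- Value of `tY` on a genuine input. [folklore] -/
@[simp] theorem tY_yIn (τ : ℕ) : tY (yIn z n a r A pad τ) = ones τ := by simp [tY, yIn]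

/-- **Value of `ansF`**: the `K` answer bits of trial `τ`. [folklore] -/
theorem ansF_apply (τ : ℕ) :
    ansF pP pD pNQ (yIn z n a r A pad τ) =
      (A.drop (τ * (pNQ.eval n + mOf (pP.eval n) (pD.eval n) a))).take (pNQ.eval n + mOf (pP.eval n) (pD.eval n) a) := by
  simp [ansF, umulFn_boolPair, ones]

/-- **Value of `candTF`**: the weak stage's candidate on the run block and run answers of trial `τ`.
[cite: ImpagliazzoWigderson2001, Lemma 18 (proof)] -/
theorem candTF_apply (τ : ℕ) :
    candTF G₁ pP pD pB pNQ (yIn z n a r A pad τ) =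
      G₁ (boolPair (boolPair (ones n) (boolPair z
          ((BPPAmp.block (pB.eval n + mOf (pP.eval n) (pD.eval n) a * n) τ r).take (pB.eval n))))
        (((A.drop (τ * (pNQ.eval n + mOf (pP.eval n) (pD.eval n) a))).take (pNQ.eval n + mOf (pP.eval n) (pD.eval n) a)).take
          (pNQ.eval n))) := by
  rw [candTF, Function.comp_apply, fanoutFn_apply, fanoutFn_apply, fanoutFn_apply, Function.comp_apply, xY_yIn, nF_xIn,
    Function.comp_apply, xY_yIn, zF_xIn, Function.comp_apply, fanoutFn_apply, xY_yIn, tY_yIn, rbF_apply,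
    Function.comp_apply, fanoutFn_apply, Function.comp_apply, xY_yIn, nQF_xIn, ansF_apply, takeFn_boolPair]
  simp [ones]

/-- **Value of `testAnsF`**: the labels of the test points of trial `τ`. [folklore] -/
theorem testAnsF_apply (τ : ℕ) :
    testAnsF pP pD pNQ (yIn z n a r A pad τ) =
      ((A.drop (τ * (pNQ.eval n + mOf (pP.eval n) (pD.eval n) a))).take (pNQ.eval n + mOf (pP.eval n) (pD.eval n) a)).drop
        (pNQ.eval n) := by
  rw [testAnsF, Function.comp_apply, fanoutFn_apply, Function.comp_apply, xY_yIn, nQF_xIn, ansF_apply, dropFn_boolPair]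
  simp [ones]

/-! #### Error pieces, empirical error, acceptance, pieces -/

/-- `ccat` has the total length of its pieces. [folklore] -/
theorem length_ccat_eq_sum (g : ℕ → List Bool) : ∀ k : ℕ, (ccat g k).length = ∑ j ∈ Finset.range k, (g j).length
  | 0 => by simp
  | k + 1 => by rw [ccat_succ, List.length_append, length_ccat_eq_sum g k, Finset.sum_range_succ]

/-- A `ccat` of pieces from `{ε, 1}` is a block of `1`s. [folklore] -/
theorem ccat_eq_ones_of_forall (g : ℕ → List Bool) (hg : ∀ j, g j = [] ∨ g j = [true]) :
    ∀ k : ℕ, ccat g k = ones (ccat g k).length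
  | 0 => by simp [ones]
  | k + 1 => by
    rw [ccat_succ, List.length_append]
    have hk : g k = ones (g k).length := by rcases hg k with h | h <;> simp [h, ones]
    conv_lhs => rw [ccat_eq_ones_of_forall g hg k, hk]
    rw [ones_append]

/-- **Every error piece is `ε` or `1`** (the condition is a one-bit equality test on every input). [folklore] -/
theorem errPieceF_cases (w : List Bool) :
    errPieceF Ev G₁ pP pD pB pNQ w = [] ∨ errPieceF Ev G₁ pP pD pB pNQ w = [true] := by
  unfold errPieceF
  rw [iteFn_apply (b := decide (_ = _)) (by rw [Function.comp_apply, fanoutFn_apply, eqPairFn_boolPair])]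
  split_ifs <;> simp

/-- Error pieces have length `≤ 1`. [folklore] -/
theorem length_errPieceF_le (w : List Bool) : (errPieceF Ev G₁ pP pD pB pNQ w).length ≤ 1 := by
  rcases errPieceF_cases (Ev := Ev) (G₁ := G₁) pP pD pB pNQ w with h | h <;> simp [h]

/-- **Value of an error piece**: `ε` iff `Ev ⟨candidate, test point s⟩` is the `s`-th label.
[cite: ImpagliazzoWigderson2001, Lemma 18 (proof)] -/
theorem errPieceF_apply (τ s : ℕ) :
    errPieceF Ev G₁ pP pD pB pNQ (boolPair (yIn z n a r A pad τ) (ones s)) =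
      if Ev (boolPair (candTF G₁ pP pD pB pNQ (yIn z n a r A pad τ))
            (testPtF pP pD pB (boolPair (boolPair (xIn z n a r) (ones τ)) (ones s)))) =
          ((testAnsF pP pD pNQ (yIn z n a r A pad τ)).drop s).take 1 then [] else [true] := by
  have hc : (eqPairFn ∘ fanoutFn (Ev ∘ fanoutFn (candTF G₁ pP pD pB pNQ ∘ fstF)
        (testPtF pP pD pB ∘ fanoutFn (fanoutFn (xY ∘ fstF) (tY ∘ fstF)) sndF))
      (takeFn ∘ fanoutFn (fun _ => ones 1) (dropFn ∘ fanoutFn sndF (testAnsF pP pD pNQ ∘ fstF))))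
      (boolPair (yIn z n a r A pad τ) (ones s)) =
      [decide (Ev (boolPair (candTF G₁ pP pD pB pNQ (yIn z n a r A pad τ))
            (testPtF pP pD pB (boolPair (boolPair (xIn z n a r) (ones τ)) (ones s)))) =
          ((testAnsF pP pD pNQ (yIn z n a r A pad τ)).drop s).take 1)] := by
    simp only [Function.comp_apply, fanoutFn_apply, fstF_boolPair, sndF_boolPair, xY_yIn, tY_yIn, takeFn_boolPair,
      dropFn_boolPair, List.length_replicate, eqPairFn_boolPair]
  rw [errPieceF, iteFn_apply hc]
  by_cases h : Ev (boolPair (candTF G₁ pP pD pB pNQ (yIn z n a r A pad τ))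
      (testPtF pP pD pB (boolPair (boolPair (xIn z n a r) (ones τ)) (ones s)))) =
      ((testAnsF pP pD pNQ (yIn z n a r A pad τ)).drop s).take 1
  · rw [decide_eq_true h, if_pos rfl, if_pos h]
  · rw [decide_eq_false h, if_neg Bool.false_ne_true, if_neg h]

/-- Monotonicity of evaluation of `ℕ`-polynomials (private copy). [folklore] -/
private theorem natPoly_eval_mono (p : Polynomial ℕ) {u v : ℕ} (h : u ≤ v) : p.eval u ≤ p.eval v :=
  TM2Iter.eval_mono p h

/-- `|xIn| ≥ n` and `≥ a`. [folklore] -/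
theorem n_le_length_xIn : n ≤ (xIn z n a r).length ∧ a ≤ (xIn z n a r).length := by
  simp only [xIn, length_boolPair, ones, List.length_replicate]; omega

/-- `|yIn| ≥ |xIn|`. [folklore] -/
theorem length_xIn_le_yIn (τ : ℕ) : (xIn z n a r).length ≤ (yIn z n a r A pad τ).length := by
  simp only [yIn, length_boolPair]; omega

/-- The number of test points is below the inner loop bound. [folklore] -/
theorem mOf_le_eval {L : ℕ} (hn : n ≤ L) (ha : a ≤ L) :
    mOf (pP.eval n) (pD.eval n) a ≤ (64 * pD ^ 2 * X ^ 2 * pP).eval L := by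
  simp only [mOf, eval_mul, eval_pow, eval_X, eval_ofNat]
  have h1 := natPoly_eval_mono pD hn
  have h2 := natPoly_eval_mono pP hn
  calc 64 * pD.eval n * pD.eval n * (a * a) * pP.eval n
      ≤ 64 * pD.eval L * pD.eval L * (L * L) * pP.eval L := by gcongr
    _ = 64 * pD.eval L ^ 2 * L ^ 2 * pP.eval L := by ring

/-- **Value of `errsF`**: the concatenation of the error pieces over the `m` test points.
[cite: ImpagliazzoWigderson2001, Lemma 18 (proof)] -/
theorem errsF_apply (τ : ℕ) :
    errsF Ev G₁ pP pD pB pNQ (yIn z n a r A pad τ) =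
      ccat (fun s => errPieceF Ev G₁ pP pD pB pNQ (boolPair (yIn z n a r A pad τ) (ones s))) (mOf (pP.eval n) (pD.eval n) a) := by
  have hm : mOf (pP.eval n) (pD.eval n) a ≤ (64 * pD ^ 2 * X ^ 2 * pP).eval (yIn z n a r A pad τ).length :=
    mOf_le_eval pP pD n a ((n_le_length_xIn z n a r).1.trans (length_xIn_le_yIn z n a r A pad τ))
      ((n_le_length_xIn z n a r).2.trans (length_xIn_le_yIn z n a r A pad τ))
  rw [errsF, Function.comp_apply, Function.comp_apply, fanoutFn_apply, fanoutFn_apply, Function.comp_apply,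
    Function.comp_apply, xY_yIn, mF_xIn, lenBinF_apply,
    show (ones (mOf (pP.eval n) (pD.eval n) a)).length = mOf (pP.eval n) (pD.eval n) a by simp [ones],
    show boolPair ([] : List Bool) [] = boolPair (ones 0) ([] : List Bool) from rfl,
    foldLoop_apply _ _ hm 0 [],
    foldAcc_clipF (fun j _ _ => (length_errPieceF_le (Ev := Ev) (G₁ := G₁) pP pD pB pNQ _).trans (by omega)),
    foldAcc_appF]
  simp [sndPow]

/-- `errsF` is a block of `1`s, one per erring test point. [folklore] -/
theorem errsF_eq_ones (τ : ℕ) :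
    errsF Ev G₁ pP pD pB pNQ (yIn z n a r A pad τ) = ones (errsF Ev G₁ pP pD pB pNQ (yIn z n a r A pad τ)).length := by
  conv_lhs => rw [errsF_apply, ccat_eq_ones_of_forall _ (fun j => errPieceF_cases (Ev := Ev) (G₁ := G₁) pP pD pB pNQ _)]
  rw [errsF_apply]

/-- **Value of the acceptance test**: `[2 · errs · D ≤ 3m]`. [cite: ImpagliazzoWigderson2001, Lemma 18 (proof)] -/
theorem accF_apply (τ : ℕ) :
    accF Ev G₁ pP pD pB pNQ (yIn z n a r A pad τ) =
      [decide (2 * (errsF Ev G₁ pP pD pB pNQ (yIn z n a r A pad τ)).length * pD.eval n ≤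
        3 * mOf (pP.eval n) (pD.eval n) a)] := by
  set E := errsF Ev G₁ pP pD pB pNQ (yIn z n a r A pad τ) with hE
  have hEE : E ++ E = ones (2 * E.length) := by
    conv_lhs => rw [hE, errsF_eq_ones]
    rw [← hE, ones_append]; ring_nf
  have hc : (ltLenF ∘ fanoutFn (appF ∘ fanoutFn (mF pP pD ∘ xY) (appF ∘ fanoutFn (mF pP pD ∘ xY) (mF pP pD ∘ xY)))
      (umulFn ∘ fanoutFn (appF ∘ fanoutFn (errsF Ev G₁ pP pD pB pNQ) (errsF Ev G₁ pP pD pB pNQ)) (DuF pD ∘ xY)))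
      (yIn z n a r A pad τ) = [decide (3 * mOf (pP.eval n) (pD.eval n) a < 2 * E.length * pD.eval n)] := by
    simp only [Function.comp_apply, fanoutFn_apply, xY_yIn, mF_xIn, appF_boolPair, ← hE, hEE, DuF_xIn, umulFn_boolPair,
      ltLenF_boolPair, List.length_append, ones, List.length_replicate]
    congr 1
    rw [decide_eq_decide]
    omega
  rw [accF, notFn_apply hc]
  simp only [List.cons.injEq, and_true]
  by_cases h : 3 * mOf (pP.eval n) (pD.eval n) a < 2 * E.length * pD.eval n
  · rw [decide_eq_true h, decide_eq_false (by omega)]; rfl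
  · rw [decide_eq_false h, decide_eq_true (by omega)]; rfl

/-- **Value of the piece of trial `τ`**: `⟨1, candidate⟩` if accepted, `ε` otherwise. [folklore] -/
theorem pieceTF_apply (τ : ℕ) :
    pieceTF Ev G₁ pP pD pB pNQ (yIn z n a r A pad τ) =
      if 2 * (errsF Ev G₁ pP pD pB pNQ (yIn z n a r A pad τ)).length * pD.eval n ≤ 3 * mOf (pP.eval n) (pD.eval n) a
      then boolPair [true] (candTF G₁ pP pD pB pNQ (yIn z n a r A pad τ)) else [] := by
  rw [pieceTF, iteFn_apply (accF_apply pP pD pB pNQ z n a r A pad τ)]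
  by_cases h : 2 * (errsF Ev G₁ pP pD pB pNQ (yIn z n a r A pad τ)).length * pD.eval n ≤ 3 * mOf (pP.eval n) (pD.eval n) a
  · rw [decide_eq_true h, if_pos rfl, if_pos h, fanoutFn_apply]
  · rw [decide_eq_false h, if_neg Bool.false_ne_true, if_neg h]

/-! #### The fold over the trials: the first non-empty piece -/

/-- The first non-empty piece among `g ⟨x, 1⁰⟩, …, g ⟨x, 1^{k-1}⟩` (`ε` if none). [folklore] -/
def firstNE (g : List Bool → List Bool) (x : List Bool) : ℕ → List Bool
  | 0 => []
  | k + 1 => if firstNE g x k = [] then g (boolPair x (ones k)) else firstNE g x k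

/-- Value of `firstOpF`. [folklore] -/
theorem firstOpF_boolPair (acc piece : List Bool) : firstOpF (boolPair acc piece) = if acc = [] then piece else acc := by
  unfold firstOpF
  rw [iteFn_apply (b := decide (acc = [])) (by rw [Function.comp_apply, fstF_boolPair]; rfl)]
  by_cases h : acc = [] <;> simp [h]

/-- **The fold with `firstOpF` keeps the first non-empty piece.** [folklore] -/
theorem foldAcc_firstOpF (g : List Bool → List Bool) (x : List Bool) : ∀ k : ℕ, foldAcc firstOpF g x 0 k [] = firstNE g x k
  | 0 => rfl
  | k + 1 => by rw [foldAcc_succ', foldAcc_firstOpF g x k, zero_add, firstOpF_boolPair, firstNE]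

/-- If all pieces are empty, `firstNE` is empty. [folklore] -/
theorem firstNE_eq_nil {g : List Bool → List Bool} {x : List Bool} :
    ∀ {k : ℕ}, (∀ j, j < k → g (boolPair x (ones j)) = []) → firstNE g x k = []
  | 0, _ => rfl
  | k + 1, h => by
    rw [firstNE, if_pos (firstNE_eq_nil fun j hj => h j (Nat.lt_succ_of_lt hj))]
    exact h k (Nat.lt_succ_self k)

/-- `firstNE` is the piece of the least index with a non-empty piece. [folklore] -/
theorem firstNE_eq_of_least {g : List Bool → List Bool} {x : List Bool} {j₀ : ℕ}
    (hj₀ : g (boolPair x (ones j₀)) ≠ []) (hlt : ∀ j, j < j₀ → g (boolPair x (ones j)) = []) :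
    ∀ {k : ℕ}, j₀ < k → firstNE g x k = g (boolPair x (ones j₀))
  | 0, h => absurd h (Nat.not_lt_zero _)
  | k + 1, h => by
    rcases Nat.lt_succ_iff_lt_or_eq.1 h with h | rfl
    · have ih := firstNE_eq_of_least hj₀ hlt h
      rw [firstNE, ih, if_neg hj₀]
    · rw [firstNE, firstNE_eq_nil hlt, if_pos rfl]

/-- **Value of the output function** on `X = ⟨x, A⟩`: the first non-empty trial piece, read without
its marker — provided every candidate fits in the pad (so no piece is clipped).
[cite: ImpagliazzoWigderson2001, Lemma 18 (proof)] -/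
theorem outF_apply
    (hcand : ∀ τ, τ < 4 * a * pP.eval n →
      (candTF G₁ pP pD pB pNQ (yIn z n a r A (ones (padP.eval (boolPair (xIn z n a r) A).length)) τ)).length ≤
        padP.eval (boolPair (xIn z n a r) A).length) :
    outF Ev G₁ pP pD pB pNQ padP (boolPair (xIn z n a r) A) =
      sndF (firstNE (pieceTF Ev G₁ pP pD pB pNQ)
        (boolPair (boolPair (xIn z n a r) A) (ones (padP.eval (boolPair (xIn z n a r) A).length))) (4 * a * pP.eval n)) := by
  set X := boolPair (xIn z n a r) A with hX
  set X' := boolPair X (ones (padP.eval X.length)) with hX'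
  have hT : 4 * a * pP.eval n ≤ (4 * Polynomial.X * pP).eval X'.length := by
    have hxX' : (xIn z n a r).length ≤ X'.length := by rw [hX', hX, length_boolPair, length_boolPair]; omega
    have hn := (n_le_length_xIn z n a r).1.trans hxX'
    have ha := (n_le_length_xIn z n a r).2.trans hxX'
    simp only [eval_mul, eval_ofNat, eval_X]
    have := natPoly_eval_mono pP hn
    calc 4 * a * pP.eval n ≤ 4 * X'.length * pP.eval X'.length := by gcongr
      _ = _ := by ring
  rw [outF, Function.comp_apply, Function.comp_apply, Function.comp_apply, initTF, fanoutFn_apply, fanoutFn_apply,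
    fanoutFn_apply, polyFn_apply, ← hX', Function.comp_apply, Function.comp_apply, show fstF X = xIn z n a r by rw [hX, fstF_boolPair],
    TF_xIn, lenBinF_apply, show (ones (4 * a * pP.eval n)).length = 4 * a * pP.eval n by simp [ones],
    show boolPair ([] : List Bool) [] = boolPair (ones 0) ([] : List Bool) from rfl,
    foldLoop_apply _ _ hT 0 []]
  rw [foldAcc_clipF (fun j _ hj => ?_), foldAcc_firstOpF]
  · simp [sndPow]
  · -- no piece is clipped: `|⟨1, cand⟩| = 4 + |cand| ≤ 4 + pad ≤ 5 (|X'| + 1)`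
    rw [zero_add] at hj
    have hpiece := pieceTF_apply (Ev := Ev) (G₁ := G₁) pP pD pB pNQ z n a r A (ones (padP.eval X.length)) j
    rw [show yIn z n a r A (ones (padP.eval X.length)) j = boolPair X' (ones j) by rw [yIn, hX', hX]] at hpiece
    rw [hpiece]
    split_ifs
    · rw [length_boolPair, List.length_singleton]
      have hc := hcand j hj
      rw [show yIn z n a r A (ones (padP.eval X.length)) j = boolPair X' (ones j) by rw [yIn, hX', hX]] at hc
      have hpad : padP.eval X.length ≤ X'.length := by
        rw [hX', length_boolPair]; simp [ones]
      omega
    · simp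

end Values

/-! ### The bridge to `Select.selOut` -/

section Bridge

variable {Ev Q₁ G₁}

/-! #### List lemmas -/

/-- A flattened map of singletons on a prefix is the map of their contents. [folklore] -/
theorem flatten_map_range_of_singleton {h : ℕ → List Bool} {b : ℕ → Bool} :
    ∀ {M : ℕ}, (∀ k, k < M → h k = [b k]) → ((List.range M).map h).flatten = (List.range M).map b
  | 0, _ => by simp
  | M + 1, hM => by
    rw [List.range_succ, List.map_append, List.flatten_append, flatten_map_range_of_singleton fun k hk => hM k (Nat.lt_succ_of_lt hk),
      List.map_append, List.map_singleton, List.map_singleton, hM M (Nat.lt_succ_self M), List.flatten_singleton]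

/-- Splitting a flattened map over `range N` at `M ≤ N`. [folklore] -/
theorem flatten_map_range_split (h : ℕ → List Bool) {M N : ℕ} (hMN : M ≤ N) :
    ((List.range N).map h).flatten = ((List.range M).map h).flatten ++ (((List.range N).drop M).map h).flatten := by
  conv_lhs => rw [← List.take_append_drop M (List.range N)]
  rw [List.map_append, List.flatten_append, List.take_range, min_eq_left hMN]

/-- **A window of a mapped range**: `(((range M).map b ++ l₂) ⇂ i) ↾ K = (range K).map (b (i + ·))` for
`i + K ≤ M`. [folklore] -/
theorem drop_take_map_range (b : ℕ → Bool) {M i K : ℕ} (h : i + K ≤ M) (l₂ : List Bool) :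
    (((List.range M).map b ++ l₂).drop i).take K = (List.range K).map fun v => b (i + v) := by
  apply List.ext_getElem
  · simp only [List.length_take, List.length_drop, List.length_append, List.length_map, List.length_range]
    omega
  · intro v h1 h2
    have hv : v < K := by simpa using h2
    rw [List.getElem_take, List.getElem_drop, List.getElem_append_left (by simp; omega), List.getElem_map, List.getElem_range,
      List.getElem_map, List.getElem_range]

/-! #### The first-accepted rule from the front, block by block -/

/-- Block `0` is the first `c` coins. [folklore] -/
theorem block_zero (c : ℕ) (y : List Bool) : BPPAmp.block c 0 y = y.take c := by simp [BPPAmp.block]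

/-- If no block among the first `T` is accepted, `firstAcc` finds nothing. [folklore] -/
theorem firstAcc_eq_none {Acc : List Bool → Bool} {c : ℕ} :
    ∀ {T : ℕ} {y : List Bool}, (∀ τ, τ < T → Acc (BPPAmp.block c τ y) = false) → Selection.firstAcc Acc c T y = none
  | 0, _, _ => rfl
  | T + 1, y, h => by
    have h0 := h 0 (Nat.succ_pos T)
    rw [block_zero] at h0
    rw [Selection.firstAcc, h0]
    exact firstAcc_eq_none fun τ hτ => by rw [← BPPAmp.block_succ]; exact h (τ + 1) (Nat.succ_lt_succ hτ)

/-- `firstAcc` returns the block of the least accepted index. [folklore] -/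
theorem firstAcc_eq_some {Acc : List Bool → Bool} {c : ℕ} :
    ∀ {T : ℕ} {y : List Bool} {τ₀ : ℕ}, τ₀ < T → Acc (BPPAmp.block c τ₀ y) = true →
      (∀ τ, τ < τ₀ → Acc (BPPAmp.block c τ y) = false) → Selection.firstAcc Acc c T y = some (BPPAmp.block c τ₀ y)
  | 0, _, _, h, _, _ => absurd h (Nat.not_lt_zero _)
  | T + 1, y, 0, _, hacc, _ => by
    rw [block_zero] at hacc ⊢
    rw [Selection.firstAcc, hacc]; rfl
  | T + 1, y, τ₀ + 1, hT, hacc, hlt => by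
    have h0 := hlt 0 (Nat.succ_pos τ₀)
    rw [block_zero] at h0
    rw [Selection.firstAcc, h0, BPPAmp.block_succ]
    exact firstAcc_eq_some (Nat.lt_of_succ_lt_succ hT) (by rw [← BPPAmp.block_succ]; exact hacc)
      fun τ hτ => by rw [← BPPAmp.block_succ]; exact hlt (τ + 1) (Nat.succ_lt_succ hτ)

/-! #### The intended queries and the candidate of a run block -/

variable (Q₁ G₁)

/-- **The intended query of global index `U`** (`U = τK + v`): run query `v` on the run block of
trial `τ`, or test point `v − nQ` of trial `τ` (the value of `qryF`, `qryF_apply`). [folklore] -/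
def qryPt (n a : ℕ) (r : List Bool) (U : ℕ) : List Bool :=
  if U % (pNQ.eval n + mOf (pP.eval n) (pD.eval n) a) < pNQ.eval n then
    Q₁ (boolPair (boolPair (ones n)
        ((BPPAmp.block (pB.eval n + mOf (pP.eval n) (pD.eval n) a * n) (U / (pNQ.eval n + mOf (pP.eval n) (pD.eval n) a)) r).take
          (pB.eval n)))
      (ones (U % (pNQ.eval n + mOf (pP.eval n) (pD.eval n) a))))
  else BPPAmp.block n (U % (pNQ.eval n + mOf (pP.eval n) (pD.eval n) a) - pNQ.eval n)
    ((BPPAmp.block (pB.eval n + mOf (pP.eval n) (pD.eval n) a * n) (U / (pNQ.eval n + mOf (pP.eval n) (pD.eval n) a)) r).drop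
      (pB.eval n))

/-- `qryF` computes `qryPt`. [folklore] -/
theorem qryF_eq_qryPt (z : List Bool) (n a : ℕ) (r : List Bool) (U : ℕ) :
    qryF Q₁ pP pD pB pNQ (boolPair (xIn z n a r) (ones U)) = qryPt Q₁ pP pD pB pNQ n a r U :=
  qryF_apply pP pD pB pNQ z n a r U

/-- **The candidate of a run block when the oracle answers `f`**: the weak stage's output map on the
`f`-values of its `nQ` run queries. [cite: ImpagliazzoWigderson2001, §2.2 (constructions "using oracle fₙ")] -/
def candOf (f : List Bool → Bool) (n : ℕ) (z rb : List Bool) : List Bool :=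
  G₁ (boolPair (boolPair (ones n) (boolPair z rb))
    ((List.range (pNQ.eval n)).map fun v => f (Q₁ (boolPair (boolPair (ones n) rb) (ones v)))))

/-- **The answer string** of the intended queries (their `f`-values) followed by anything. [folklore] -/
def ansStr (f : List Bool → Bool) (n a : ℕ) (r l₂ : List Bool) : List Bool :=
  (List.range (4 * a * pP.eval n * (pNQ.eval n + mOf (pP.eval n) (pD.eval n) a))).map
      (fun k => f (qryPt Q₁ pP pD pB pNQ n a r k)) ++ l₂

/-- The answers of trial `τ < T` inside `ansStr`. [folklore] -/
theorem ansSlice_eq (f : List Bool → Bool) (n a : ℕ) (r l₂ : List Bool) {τ : ℕ} (hτ : τ < 4 * a * pP.eval n) :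
    ((ansStr Q₁ pP pD pB pNQ f n a r l₂).drop (τ * (pNQ.eval n + mOf (pP.eval n) (pD.eval n) a))).take
        (pNQ.eval n + mOf (pP.eval n) (pD.eval n) a) =
      (List.range (pNQ.eval n + mOf (pP.eval n) (pD.eval n) a)).map fun v =>
        f (qryPt Q₁ pP pD pB pNQ n a r (τ * (pNQ.eval n + mOf (pP.eval n) (pD.eval n) a) + v)) := by
  rw [ansStr]
  exact drop_take_map_range _ (by nlinarith) l₂

variable {Q₁ G₁}

/-- The run queries of trial `τ` are the intended queries `τK + v`, `v < nQ`. [folklore] -/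
theorem qryPt_run (n a : ℕ) (r : List Bool) {τ v : ℕ} (hv : v < pNQ.eval n) :
    qryPt Q₁ pP pD pB pNQ n a r (τ * (pNQ.eval n + mOf (pP.eval n) (pD.eval n) a) + v) =
      Q₁ (boolPair (boolPair (ones n)
        ((BPPAmp.block (pB.eval n + mOf (pP.eval n) (pD.eval n) a * n) τ r).take (pB.eval n))) (ones v)) := by
  have hK : 0 < pNQ.eval n + mOf (pP.eval n) (pD.eval n) a := by omega
  have hvK : v < pNQ.eval n + mOf (pP.eval n) (pD.eval n) a := by omega
  have hmod : (τ * (pNQ.eval n + mOf (pP.eval n) (pD.eval n) a) + v) % (pNQ.eval n + mOf (pP.eval n) (pD.eval n) a) = v := by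
    rw [mul_comm, Nat.mul_add_mod, Nat.mod_eq_of_lt hvK]
  have hdiv : (τ * (pNQ.eval n + mOf (pP.eval n) (pD.eval n) a) + v) / (pNQ.eval n + mOf (pP.eval n) (pD.eval n) a) = τ := by
    rw [add_comm, Nat.add_mul_div_right _ _ hK, Nat.div_eq_of_lt hvK, zero_add]
  rw [qryPt, hmod, hdiv, if_pos hv]

/-- The test queries of trial `τ` are the intended queries `τK + nQ + s`, `s < m`. [folklore] -/
theorem qryPt_test (n a : ℕ) (r : List Bool) {τ s : ℕ} (hs : s < mOf (pP.eval n) (pD.eval n) a) :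
    qryPt Q₁ pP pD pB pNQ n a r (τ * (pNQ.eval n + mOf (pP.eval n) (pD.eval n) a) + (pNQ.eval n + s)) =
      BPPAmp.block n s ((BPPAmp.block (pB.eval n + mOf (pP.eval n) (pD.eval n) a * n) τ r).drop (pB.eval n)) := by
  have hK : 0 < pNQ.eval n + mOf (pP.eval n) (pD.eval n) a := by omega
  have hvK : pNQ.eval n + s < pNQ.eval n + mOf (pP.eval n) (pD.eval n) a := by omega
  have hmod : (τ * (pNQ.eval n + mOf (pP.eval n) (pD.eval n) a) + (pNQ.eval n + s)) % (pNQ.eval n + mOf (pP.eval n) (pD.eval n) a) =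
      pNQ.eval n + s := by
    rw [mul_comm, Nat.mul_add_mod, Nat.mod_eq_of_lt hvK]
  have hdiv : (τ * (pNQ.eval n + mOf (pP.eval n) (pD.eval n) a) + (pNQ.eval n + s)) / (pNQ.eval n + mOf (pP.eval n) (pD.eval n) a) = τ := by
    rw [add_comm, Nat.add_mul_div_right _ _ hK, Nat.div_eq_of_lt hvK, zero_add]
  rw [qryPt, hmod, hdiv, if_neg (by omega), Nat.add_sub_cancel_left]

end Bridge

/-! #### One trial, when the answers are the `f`-values of the intended queries -/

section Trial

variable {Ev Q₁ G₁} (f : List Bool → Bool) (z : List Bool) (n a : ℕ) (r pad l₂ : List Bool)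

/-- **The machine's candidate is `candOf`** on the run block of trial `τ`. [folklore] -/
theorem candTF_eq_candOf {τ : ℕ} (hτ : τ < 4 * a * pP.eval n) :
    candTF G₁ pP pD pB pNQ (yIn z n a r (ansStr Q₁ pP pD pB pNQ f n a r l₂) pad τ) =
      candOf Q₁ G₁ pNQ f n z ((BPPAmp.block (pB.eval n + mOf (pP.eval n) (pD.eval n) a * n) τ r).take (pB.eval n)) := by
  rw [candTF_apply, ansSlice_eq Q₁ pP pD pB pNQ f n a r l₂ hτ, ← List.map_take, List.take_range,
    min_eq_left (Nat.le_add_right _ _), candOf]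
  congr 2
  refine List.map_congr_left fun v hv => ?_
  rw [qryPt_run pP pD pB pNQ n a r (List.mem_range.1 hv)]

/-- **The machine's error piece**, for `s < m`: `ε` iff the candidate is right on test point `s`.
[folklore] -/
theorem errPieceF_eq {τ s : ℕ} (hτ : τ < 4 * a * pP.eval n) (hs : s < mOf (pP.eval n) (pD.eval n) a) :
    errPieceF Ev G₁ pP pD pB pNQ (boolPair (yIn z n a r (ansStr Q₁ pP pD pB pNQ f n a r l₂) pad τ) (ones s)) =
      if Ev (boolPair (candOf Q₁ G₁ pNQ f n z ((BPPAmp.block (pB.eval n + mOf (pP.eval n) (pD.eval n) a * n) τ r).take (pB.eval n)))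
            (BPPAmp.block n s ((BPPAmp.block (pB.eval n + mOf (pP.eval n) (pD.eval n) a * n) τ r).drop (pB.eval n)))) =
          [f (BPPAmp.block n s ((BPPAmp.block (pB.eval n + mOf (pP.eval n) (pD.eval n) a * n) τ r).drop (pB.eval n)))]
      then [] else [true] := by
  rw [errPieceF_apply, candTF_eq_candOf pP pD pB pNQ f z n a r pad l₂ hτ, testPtF_apply, testAnsF_apply,
    ansSlice_eq Q₁ pP pD pB pNQ f n a r l₂ hτ, List.drop_drop, List.take_one_drop_eq_of_lt_length (by simpa using hs)]
  simp only [List.get_eq_getElem, List.getElem_map, List.getElem_range]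
  rw [qryPt_test pP pD pB pNQ n a r hs]

/-- **The machine's empirical error is `BPPAmp.nbad`** of the error set of the candidate over the test
block. [folklore] -/
theorem length_errsF_eq_nbad {τ : ℕ} (hτ : τ < 4 * a * pP.eval n) :
    (errsF Ev G₁ pP pD pB pNQ (yIn z n a r (ansStr Q₁ pP pD pB pNQ f n a r l₂) pad τ)).length =
      BPPAmp.nbad (mOf (pP.eval n) (pD.eval n) a) n
        (Select.errSet Ev f (candOf Q₁ G₁ pNQ f n z ((BPPAmp.block (pB.eval n + mOf (pP.eval n) (pD.eval n) a * n) τ r).take (pB.eval n))))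
        ((BPPAmp.block (pB.eval n + mOf (pP.eval n) (pD.eval n) a * n) τ r).drop (pB.eval n)) := by
  rw [errsF_apply, length_ccat_eq_sum, BPPAmp.nbad]
  refine Finset.sum_congr rfl fun s hs => ?_
  rw [errPieceF_eq pP pD pB pNQ f z n a r pad l₂ hτ (Finset.mem_range.1 hs)]
  simp only [Select.errSet, Set.mem_setOf_eq, ne_eq]
  split_ifs <;> simp_all

/-- **Acceptance, integer form**: `e ≤ 3/2 · (1/D) · m ↔ 2eD ≤ 3m`. [folklore] -/
theorem acc_real_iff {e D m : ℕ} (hD : 1 ≤ D) : ((e : ℝ) ≤ 3 / 2 * (1 / (D : ℝ)) * m) ↔ 2 * e * D ≤ 3 * m := by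
  have hDr : (0 : ℝ) < D := by exact_mod_cast hD
  rw [show (3 : ℝ) / 2 * (1 / D) * m = 3 * m / (2 * D) by field_simp, le_div_iff₀ (by positivity)]
  constructor
  · intro h
    have h' : ((2 * e * D : ℕ) : ℝ) ≤ ((3 * m : ℕ) : ℝ) := by push_cast; nlinarith
    exact_mod_cast h'
  · intro h
    have h' : ((2 * e * D : ℕ) : ℝ) ≤ ((3 * m : ℕ) : ℝ) := by exact_mod_cast h
    push_cast at h'; nlinarith

/-- **The machine's piece of trial `τ`**: `⟨1, candOf (run block)⟩` if the trial is accepted in the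
sense of `Select.Acc`, `ε` otherwise. [folklore] -/
theorem pieceTF_eq (hD : 1 ≤ pD.eval n) {τ : ℕ} (hτ : τ < 4 * a * pP.eval n) :
    pieceTF Ev G₁ pP pD pB pNQ (yIn z n a r (ansStr Q₁ pP pD pB pNQ f n a r l₂) pad τ) =
      if Select.Acc Ev f n (candOf Q₁ G₁ pNQ f n z) (pB.eval n) (mOf (pP.eval n) (pD.eval n) a) (1 / ((pD.eval n : ℕ) : ℝ))
          (BPPAmp.block (pB.eval n + mOf (pP.eval n) (pD.eval n) a * n) τ r) = true
      then boolPair [true] (candOf Q₁ G₁ pNQ f n z ((BPPAmp.block (pB.eval n + mOf (pP.eval n) (pD.eval n) a * n) τ r).take (pB.eval n)))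
      else [] := by
  rw [pieceTF_apply, length_errsF_eq_nbad pP pD pB pNQ f z n a r pad l₂ hτ, candTF_eq_candOf pP pD pB pNQ f z n a r pad l₂ hτ]
  have hacc : Select.Acc Ev f n (candOf Q₁ G₁ pNQ f n z) (pB.eval n) (mOf (pP.eval n) (pD.eval n) a) (1 / ((pD.eval n : ℕ) : ℝ))
      (BPPAmp.block (pB.eval n + mOf (pP.eval n) (pD.eval n) a * n) τ r) = true ↔
      2 * BPPAmp.nbad (mOf (pP.eval n) (pD.eval n) a) n
        (Select.errSet Ev f (candOf Q₁ G₁ pNQ f n z ((BPPAmp.block (pB.eval n + mOf (pP.eval n) (pD.eval n) a * n) τ r).take (pB.eval n))))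
        ((BPPAmp.block (pB.eval n + mOf (pP.eval n) (pD.eval n) a * n) τ r).drop (pB.eval n)) * pD.eval n ≤
      3 * mOf (pP.eval n) (pD.eval n) a := by
    rw [Select.Acc, decide_eq_true_eq, Select.empErr, acc_real_iff hD]
  by_cases h : 2 * BPPAmp.nbad (mOf (pP.eval n) (pD.eval n) a) n
      (Select.errSet Ev f (candOf Q₁ G₁ pNQ f n z ((BPPAmp.block (pB.eval n + mOf (pP.eval n) (pD.eval n) a * n) τ r).take (pB.eval n))))
      ((BPPAmp.block (pB.eval n + mOf (pP.eval n) (pD.eval n) a * n) τ r).drop (pB.eval n)) * pD.eval n ≤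
      3 * mOf (pP.eval n) (pD.eval n) a
  · rw [if_pos h, if_pos (hacc.2 h)]
  · rw [if_neg h, if_neg (fun h' => h (hacc.1 h'))]

/-- A pair code is never empty. [folklore] -/
theorem boolPair_ne_nil (u v : List Bool) : boolPair u v ≠ [] := fun h => by
  have := congrArg List.length h
  rw [length_boolPair] at this
  simp at this

/-- **The transducer's output is `Select.selOut`.** On `⟨x, A⟩` with `A` the `f`-values of the
intended queries (followed by anything), the machine outputs the candidate of the first trial
accepted in the sense of `Select.Acc` — i.e. `Select.selOut` for the candidate map `candOf`.
[cite: ImpagliazzoWigderson2001, Lemma 18 (proof, last paragraph)] -/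
theorem outF_eq_selOut (hD : 1 ≤ pD.eval n)
    (hcand : ∀ τ, τ < 4 * a * pP.eval n →
      (candTF G₁ pP pD pB pNQ (yIn z n a r (ansStr Q₁ pP pD pB pNQ f n a r l₂)
        (ones (padP.eval (boolPair (xIn z n a r) (ansStr Q₁ pP pD pB pNQ f n a r l₂)).length)) τ)).length ≤
        padP.eval (boolPair (xIn z n a r) (ansStr Q₁ pP pD pB pNQ f n a r l₂)).length) :
    outF Ev G₁ pP pD pB pNQ padP (boolPair (xIn z n a r) (ansStr Q₁ pP pD pB pNQ f n a r l₂)) =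
      Select.selOut Ev f n (candOf Q₁ G₁ pNQ f n z) (pB.eval n) (mOf (pP.eval n) (pD.eval n) a) (1 / ((pD.eval n : ℕ) : ℝ))
        (4 * a * pP.eval n) r := by
  set A := ansStr Q₁ pP pD pB pNQ f n a r l₂ with hA
  set X := boolPair (xIn z n a r) A with hX
  set pd := ones (padP.eval X.length) with hpd
  set X' := boolPair X pd with hX'
  set T := 4 * a * pP.eval n with hT
  set c := pB.eval n + mOf (pP.eval n) (pD.eval n) a * n with hc
  set Acc := Select.Acc Ev f n (candOf Q₁ G₁ pNQ f n z) (pB.eval n) (mOf (pP.eval n) (pD.eval n) a) (1 / ((pD.eval n : ℕ) : ℝ)) with hAcc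
  rw [outF_apply (hcand := hcand)]
  have hy : ∀ τ, boolPair X' (ones τ) = yIn z n a r A pd τ := fun τ => by rw [yIn, hX', hX]
  have hpiece : ∀ τ, τ < T → pieceTF Ev G₁ pP pD pB pNQ (boolPair X' (ones τ)) =
      if Acc (BPPAmp.block c τ r) = true then
        boolPair [true] (candOf Q₁ G₁ pNQ f n z ((BPPAmp.block c τ r).take (pB.eval n))) else [] := fun τ hτ => by
    rw [hy, hA, pieceTF_eq pP pD pB pNQ f z n a r pd l₂ hD hτ]
  by_cases hex : ∃ τ, τ < T ∧ Acc (BPPAmp.block c τ r) = true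
  · classical
    have hspec := Nat.find_spec hex
    have hmin : ∀ τ, τ < Nat.find hex → Acc (BPPAmp.block c τ r) = false := fun τ hτ => by
      have h := Nat.find_min hex hτ
      rw [not_and] at h
      simpa using h (hτ.trans hspec.1)
    have hfirst : firstNE (pieceTF Ev G₁ pP pD pB pNQ) X' T =
        boolPair [true] (candOf Q₁ G₁ pNQ f n z ((BPPAmp.block c (Nat.find hex) r).take (pB.eval n))) := by
      rw [firstNE_eq_of_least (j₀ := Nat.find hex) (by rw [hpiece _ hspec.1, if_pos hspec.2]; exact boolPair_ne_nil _ _)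
          (fun τ hτ => by rw [hpiece _ (hτ.trans hspec.1), if_neg (by rw [hmin τ hτ]; exact Bool.false_ne_true)]) hspec.1,
        hpiece _ hspec.1, if_pos hspec.2]
    rw [hfirst, sndF_boolPair, Select.selOut, ← hAcc, ← hc, firstAcc_eq_some hspec.1 hspec.2 hmin]
  · have hall : ∀ τ, τ < T → Acc (BPPAmp.block c τ r) = false := fun τ hτ => by
      simpa using (not_and.1 (not_exists.1 hex τ)) hτ
    rw [firstNE_eq_nil (fun τ hτ => by rw [hpiece τ hτ, if_neg (by rw [hall τ hτ]; exact Bool.false_ne_true)]), HashBricks.sndF_nil,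
      Select.selOut, ← hAcc, ← hc, firstAcc_eq_none hall]

end Trial

/-! ### The reduction from a weak stage -/

section Final

variable {Ev Q₁ G₁}

/-- An `FP` function has polynomially bounded output length. [cite: AroraBarakCC2009, §1.3] -/
private theorem exists_poly_length_of_mem_FP {g : List Bool → List Bool} (hg : g ∈ FP) :
    ∃ sg : Polynomial ℕ, ∀ w : List Bool, (g w).length ≤ sg.eval w.length := by
  obtain ⟨p, M, hM⟩ := hg
  refine ⟨X + C (TM2Comp.machinePushBound M.tm) * p, fun w => ?_⟩
  have hl := (hM w).length_le
  simpa [id] using hl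

/-- A full block has the block length. [folklore] -/
theorem length_block {P j : ℕ} {y : List Bool} (h : (j + 1) * P ≤ y.length) : (BPPAmp.block P j y).length = P := by
  rw [BPPAmp.block, List.length_take, List.length_drop]
  have h' : (j + 1) * P = j * P + P := by ring
  omega

/-- Monotonicity of evaluation of `ℕ`-polynomials (private copy). [folklore] -/
private theorem natPoly_eval_mono'' (p : Polynomial ℕ) {u v : ℕ} (h : u ≤ v) : p.eval u ≤ p.eval v :=
  TM2Iter.eval_mono p h

/-- **Impagliazzo–Wigderson's `A →^{fₙ} C^{f,1−2/D}` from a WEAK one-run stage.** Let the weak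
stage be given by `Q₁, G₁ ∈ FP` — run query `v < nQ(n)` on `⟨⟨1ⁿ, run block⟩, 1ᵛ⟩`, of length `n`
on run blocks of length `P₁(n)`, and the candidate `G₁ ⟨⟨1ⁿ, ⟨z, run block⟩⟩, answers⟩` — and
suppose that for every instance `z ∈ Aₙ` its candidate `candOf` (computed with the true `f`-values)
has error `≤ 1/D(n)` for at least a `1/P(n)` fraction of the run blocks. Then the transducer
`ttFnAlg qryF q outF` (run the stage `T = 4aP` times, test each candidate on `m = 64D²a²P` membership
queries, keep the first with empirical error `≤ 3m/(2D)`) is a probabilistic-polynomial-time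
construction of `C^{f,1−2/D}` from `A` using `fₙ`. [cite: ImpagliazzoWigderson2001, Def. 4, Lemma 14 and Lemma 18 (proof)] -/
theorem _root_.Literature.Computability.Complexity.IWUniform.reducibleUsing_of_weakStage {A : ConstructionProblem}
    {Ev Q₁ G₁ : List Bool → List Bool} {f : List Bool → Bool} (hEv : Ev ∈ FP) (hQ : Q₁ ∈ FP) (hG : G₁ ∈ FP)
    {pP pD pB pNQ : Polynomial ℕ} (hP : ∀ n, 1 ≤ pP.eval n) (hD : ∀ n, 1 ≤ pD.eval n)
    (hQlen : ∀ (n : ℕ) (rb : List Bool) (v : ℕ), rb.length = pB.eval n → v < pNQ.eval n →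
      (Q₁ (boolPair (boolPair (ones n) rb) (ones v))).length = n)
    (hweak : ∀ n, ∀ z ∈ A n, 1 / ((pP.eval n : ℕ) : ℝ) ≤
      uniformProb (pB.eval n) {rb | Select.errProb Ev f n (candOf Q₁ G₁ pNQ f n z rb) ≤ 1 / ((pD.eval n : ℕ) : ℝ)}) :
    ReducibleUsing A (approxCircuits Ev f fun n => 2 / ((pD.eval n : ℕ) : ℝ)) f id := by
  obtain ⟨sG, hsG⟩ := exists_poly_length_of_mem_FP hG
  set padP : Polynomial ℕ := sG.comp (8 * X + 10 + 2 * pB + pNQ) with hpadP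
  set qpoly : Polynomial ℕ := 4 * X * pP * (pNQ + 64 * pD ^ 2 * X ^ 2 * pP) with hqpoly
  set pcoins : Polynomial ℕ := 4 * X * pP * (pB + 64 * pD ^ 2 * X ^ 2 * pP * X) with hpcoins
  refine reducibleUsing_of_selOut (P := fun n => pP.eval n) (D := fun n => pD.eval n) (P₁ := fun n => pB.eval n) hP hD
    (cand := fun n z rb => candOf Q₁ G₁ pNQ f n z rb) hweak
    (C := ttFnAlg (qryF Q₁ pP pD pB pNQ) qpoly (outF Ev G₁ pP pD pB pNQ padP))
    (isPolyTime_ttFnAlg (qryF_mem_FP pP pD pB pNQ hQ) (outF_mem_FP pP pD pB pNQ padP hEv hG))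
    (b := qpoly + 1) (p := pcoins) (fun z n a => ?_) (fun n a ha z hz O hO r hr => ?_)
  · -- the coins are long enough
    have hn : n ≤ z.length + n + a := by omega
    have ha : a ≤ z.length + n + a := by omega
    have h1 := natPoly_eval_mono'' pP hn; have h2 := natPoly_eval_mono'' pD hn; have h3 := natPoly_eval_mono'' pB hn
    simp only [hpcoins, eval_mul, eval_add, eval_pow, eval_X, eval_ofNat]
    calc 4 * a * pP.eval n * (pB.eval n + 64 * pD.eval n ^ 2 * a ^ 2 * pP.eval n * n)
        ≤ 4 * (z.length + n + a) * pP.eval (z.length + n + a) *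
          (pB.eval (z.length + n + a) + 64 * pD.eval (z.length + n + a) ^ 2 * (z.length + n + a) ^ 2 *
            pP.eval (z.length + n + a) * (z.length + n + a)) := by gcongr
      _ = _ := by ring
  · -- the run: answers are the `f`-values of the intended queries, then `outF_eq_selOut`
    set P := pP.eval n with hPdef
    set D := pD.eval n with hDdef
    set P₁ := pB.eval n with hP₁
    set nQ := pNQ.eval n with hnQ
    set m := mOf P D a with hm
    set K := nQ + m with hK
    set T := 4 * a * P with hT
    set c := P₁ + m * n with hc
    set x := xIn z n a r with hx
    have hmeq : 64 * D ^ 2 * a ^ 2 * P = m := by rw [hm, mOf_eq]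
    have hm0 : 0 < m := by rw [hm, mOf]; have := hP n; have := hD n; positivity
    -- coins cover all trial blocks
    have hrlen : T * c ≤ r.length := by
      rw [hr, hT, hc, ← hmeq]
      have hn : n ≤ z.length + n + a := by omega
      have ha' : a ≤ z.length + n + a := by omega
      have h1 := natPoly_eval_mono'' pP hn; have h2 := natPoly_eval_mono'' pD hn; have h3 := natPoly_eval_mono'' pB hn
      simp only [hpcoins, eval_mul, eval_add, eval_pow, eval_X, eval_ofNat]
      calc 4 * a * P * (P₁ + 64 * D ^ 2 * a ^ 2 * P * n)
          ≤ 4 * (z.length + n + a) * pP.eval (z.length + n + a) *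
            (pB.eval (z.length + n + a) + 64 * pD.eval (z.length + n + a) ^ 2 * (z.length + n + a) ^ 2 *
              pP.eval (z.length + n + a) * (z.length + n + a)) := by rw [hPdef, hDdef, hP₁]; gcongr
        _ = _ := by ring
    -- the intended queries have length `n`
    have hqlen : ∀ k, k < T * K → (qryPt Q₁ pP pD pB pNQ n a r k).length = n := by
      intro k hk
      have hK0 : 0 < K := by omega
      have hτ : k / K < T := (Nat.div_lt_iff_lt_mul hK0).2 hk
      have hv : k % K < K := Nat.mod_lt _ hK0
      have hblk : (BPPAmp.block c (k / K) r).length = c :=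
        length_block ((Nat.mul_le_mul_right c (Nat.succ_le_of_lt hτ)).trans hrlen)
      rw [qryPt]
      simp only [← hPdef, ← hDdef, ← hP₁, ← hnQ, ← hm, ← hK, ← hc]
      split_ifs with h
      · refine hQlen n _ _ ?_ h
        rw [List.length_take, hblk, hc]; exact min_eq_left (Nat.le_add_right _ _)
      · refine length_block ?_
        rw [List.length_drop, hblk, hc, Nat.add_sub_cancel_left]
        have : k % K - nQ < m := by omega
        exact Nat.mul_le_mul_right n (Nat.succ_le_of_lt this)
    -- the oracle answers them by `f`
    have hO' : ∀ k, k < T * K → O (qryF Q₁ pP pD pB pNQ (boolPair x (List.replicate k true))) = [f (qryPt Q₁ pP pD pB pNQ n a r k)] := by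
      intro k hk
      rw [hx, show List.replicate k true = ones k from rfl, qryF_eq_qryPt]
      exact hO _ (hqlen k hk)
    -- there are enough rounds for the intended queries
    have hTK : T * K ≤ qpoly.eval x.length := by
      have hnx : n ≤ x.length := (n_le_length_xIn z n a r).1
      have hax : a ≤ x.length := (n_le_length_xIn z n a r).2
      have h1 := natPoly_eval_mono'' pP hnx; have h2 := natPoly_eval_mono'' pD hnx; have h3 := natPoly_eval_mono'' pNQ hnx
      rw [hT, hK, hm, mOf]
      simp only [hqpoly, eval_mul, eval_add, eval_pow, eval_X, eval_ofNat]
      calc 4 * a * P * (nQ + 64 * D * D * (a * a) * P)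
          ≤ 4 * x.length * pP.eval x.length * (pNQ.eval x.length + 64 * pD.eval x.length * pD.eval x.length *
              (x.length * x.length) * pP.eval x.length) := by rw [hPdef, hDdef, hnQ]; gcongr
        _ = _ := by ring
    -- the answer string is `ansStr`
    have hA : ((List.range (qpoly.eval x.length)).map fun k => O (qryF Q₁ pP pD pB pNQ (boolPair x (List.replicate k true)))).flatten =
        ansStr Q₁ pP pD pB pNQ f n a r
          ((((List.range (qpoly.eval x.length)).drop (T * K)).map fun k =>
            O (qryF Q₁ pP pD pB pNQ (boolPair x (List.replicate k true)))).flatten) := by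
      rw [flatten_map_range_split _ hTK, flatten_map_range_of_singleton hO', ansStr]
    -- the run
    rw [reduceInput_eq_xIn, ← hx, run_ttFnAlg_oracle O x (by simp), hA, hx]
    congr 1
    rw [show (64 * D ^ 2 * a ^ 2 * P) = m from hmeq]
    refine outF_eq_selOut pP pD pB pNQ padP f z n a r _ (hD n) fun τ hτ => ?_
    -- every candidate fits in the pad
    set A' := ansStr Q₁ pP pD pB pNQ f n a r ((((List.range (qpoly.eval x.length)).drop (T * K)).map fun k =>
            O (qryF Q₁ pP pD pB pNQ (boolPair x (List.replicate k true)))).flatten) with hA'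
    set Xw := boolPair (xIn z n a r) A' with hXw
    rw [candTF_apply]
    refine (hsG _).trans ?_
    have hnX : n ≤ Xw.length := (n_le_length_xIn z n a r).1.trans (by rw [hXw, length_boolPair]; omega)
    have hzX : z.length ≤ Xw.length := by
      rw [hXw, length_boolPair, xIn, length_boolPair]; omega
    have hrb : ((BPPAmp.block (pB.eval n + mOf (pP.eval n) (pD.eval n) a * n) τ r).take (pB.eval n)).length ≤ pB.eval Xw.length :=
      (List.length_take_le _ _).trans (natPoly_eval_mono'' pB hnX)
    have hans : ((((A'.drop (τ * (pNQ.eval n + mOf (pP.eval n) (pD.eval n) a))).take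
        (pNQ.eval n + mOf (pP.eval n) (pD.eval n) a))).take (pNQ.eval n)).length ≤ pNQ.eval Xw.length :=
      (List.length_take_le _ _).trans (natPoly_eval_mono'' pNQ hnX)
    rw [hpadP, eval_comp]
    refine natPoly_eval_mono'' sG ?_
    simp only [length_boolPair, eval_add, eval_mul, eval_ofNat, eval_X, ones, List.length_replicate]
    omega

end Final

end SelectT

end IWUniform

end Literature.Computability.Complexity

end
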